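/-
Origin: expansion seat `planner-pub-hodgecm-toy2-g2-0`, handover 2026-08-18 (`HOME/pub-hodgecm-toy2-g2/lean/Toy2g2/PerLInhabited.lean`, md5 e15fb45f, 93 lines);
landed by the gen-6 packager in gate run 22 as `HodgeCM/Model/PerLInhabited.lean` (import ^import Toy2g2\.→import HodgeCM.Model.SexticCM. ×2).
-/
/-
Copyright: pub-hodgecm formalisation cell (harness21, 2026). New file (not vendored).
Origin: HOME/pub-hodgecm-toy2-g2/lean/Toy2g2/PerLInhabited.lean (WIP module `Toy2g2.PerLInhabited`; intended final place
`HodgeCM/Model/PerLInhabited.lean` = module `HodgeCM.Model.PerLInhabited`, CONTRIBUTING §3 L5) (seat planner-pub-hodgecm-toy2-g2-0,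
consistency seat 2 gen 2, part (6a)(ii): PerL's hypotheses are inhabited — HodgeCM.perLHypothesesInhabited and the unconditional PerL-side non-vacuity corollaries).
-/
import Summits.HodgeConjecture.HodgeCM.Model.SexticCM.Degree
import Summits.HodgeConjecture.HodgeCM.Model.SexticCM.Frame
import Summits.HodgeConjecture.HodgeCM.Model.NonVacuity

/-!
# PerL's hypotheses are inhabited; hence `PerL`, `PerL44`, `RealisationExistsPerL` FAIL in every period-free shadow

`HodgeCM.perLHypothesesInhabited : PerLHypothesesInhabited` — the explicit witness is the non-Galois sextic CM field
`K = ℚ(δ₀) ⊂ ℂ`, `δ₀ = i√(2-α₀)`, `α₀` a root of `x³ - 4x + 1` (minimal polynomial `m_κ = X⁶+6X⁴+8X²+1`, maximal real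
subfield `ℚ(2-α₀)` with minimal polynomial `X³-6X²+8X-1`), its normal closure `E = ℚ(±δ₀, ±δ₁, ±δ₂) ⊂ ℂ` (a CM field,
Galois over `ℚ`, `[E:ℚ] ∈ {24, 48}`), the frame `φ_j : δ₀ ↦ δ_j` and the four CM types of sign pattern `perlSign`.

Consequences (discharging the hypothesis `PerLHypothesesInhabited` of `HodgeCM/Model/NonVacuity.lean`): for EVERY
universe `U`, `¬ U.periodFree.PerL`, `¬ U.periodFree.PerL44`, and (under `Fact_pull_hodge`) `¬ U.periodFree.RealisationExistsPerL`;
so the open input `RealisationExistsPerL` and the conclusions `PerL` / `PerL44` are NOT consequences of the 28 model facts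
(relative to their consistency: `exists_model_not_perL`), i.e. `Universe.PerL` is non-vacuous (referee A r13, FACTS.md H11).
-/

noncomputable section

namespace HodgeCM

open SexticCM

/-- the sextic CM field `K = ℚ(δ₀)` and its normal closure `E`, as `CMField`s -/
abbrev SexticCM.Kcm : CMField := ⟨K⟩
/-- (Ported verbatim from the HodgeCMPerL package; no docstring in the source.) -/
abbrev SexticCM.Ecm : CMField := ⟨E⟩

/-- **PerL's hypotheses are inhabited** (kernel-checked witness: the sextic CM field `ℚ(i√(2-α₀))`, `α₀³-4α₀+1=0`). -/
theorem perLHypothesesInhabited : PerLHypothesesInhabited := by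
  refine ⟨Kcm, Ecm, jKE, ?_, ?_, ?_, φfr, isFrame, ιE, ?_, Ψfr, isPerLTypes⟩
  · convert instIsNormalClosure
  · convert finrank_K
  · convert finrank_E
  · rw [φfr_zero]; rfl

namespace Universe

variable (U : Universe)

/-- For every universe, `W_per^L` (PerL verbatim) FAILS in its period-free shadow. -/
theorem not_perL_periodFree : ¬ U.periodFree.PerL :=
  fun h => U.periodFree_perL_iff.mp h perLHypothesesInhabited

/-- For every universe, PerL Thm 4.4 FAILS in its period-free shadow. -/
theorem not_perL44_periodFree : ¬ U.periodFree.PerL44 :=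
  fun h => U.periodFree_perL44_iff.mp h perLHypothesesInhabited

/-- For every universe with `Fact_pull_hodge`, the open input `RealisationExistsPerL` FAILS in its period-free shadow. -/
theorem not_realisationExistsPerL_periodFree (hH : U.Fact_pull_hodge) : ¬ U.periodFree.RealisationExistsPerL :=
  fun h => (U.periodFree_realisationExistsPerL_iff hH).mp h perLHypothesesInhabited

/-- **Separating model for the realisation inputs, unconditional form** of `separating_realisation`. -/
theorem separating_realisation_perL (M : U.ModelAxioms) :
    U.periodFree.ModelAxioms ∧
    (U.periodFree.HC_CM ↔ U.HC_CM) ∧ (U.periodFree.PohlmannSpan ↔ U.PohlmannSpan) ∧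
    (U.periodFree.Qw8Sufficiency ↔ U.Qw8Sufficiency) ∧ (U.periodFree.W_RK4 ↔ U.W_RK4) ∧
    ¬ U.periodFree.RealisationExistsFace ∧ ¬ U.periodFree.PeriodThmF ∧
    ¬ U.periodFree.RealisationExistsPerL ∧ ¬ U.periodFree.PerL ∧ ¬ U.periodFree.PerL44 := by
  obtain ⟨M', hHC, hP, hQ, hW, hF, hT, hPerL⟩ := U.separating_realisation M
  exact ⟨M', hHC, hP, hQ, hW, hF, hT, hPerL perLHypothesesInhabited⟩

end Universe

/-- **`RealisationExistsPerL`, `PerL`, `PerL44` are not consequences of the 28 facts + the other open inputs.**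
If the 28 facts and the four open inputs are jointly satisfiable, there is a universe satisfying the 28 facts, both
reduction inputs, `HC_CM` and `W_RK4`, in which all five realisation-side statements FAIL. -/
theorem exists_model_not_realisation_perL (h : ∃ U : Universe, U.ModelAxioms ∧ U.OpenInputs) :
    ∃ U' : Universe, U'.ModelAxioms ∧ U'.PohlmannSpan ∧ U'.Qw8Sufficiency ∧ U'.HC_CM ∧ U'.W_RK4 ∧
      ¬ U'.RealisationExistsFace ∧ ¬ U'.PeriodThmF ∧
      ¬ U'.RealisationExistsPerL ∧ ¬ U'.PerL ∧ ¬ U'.PerL44 := by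
  obtain ⟨U', M', hP, hQ, hHC, hW, hF, hT, hPerL⟩ := exists_model_not_realisation h
  exact ⟨U', M', hP, hQ, hHC, hW, hF, hT, hPerL perLHypothesesInhabited⟩

/-- Consistency of the 28 facts alone already yields a model of the 28 facts refuting `RealisationExistsPerL`,
`PerL` and `PerL44` (and `RealisationExistsFace`, rfwf Thm 4.1). -/
theorem exists_model_not_perL (h : ∃ U : Universe, U.ModelAxioms) :
    ∃ U' : Universe, U'.ModelAxioms ∧ ¬ U'.RealisationExistsPerL ∧ ¬ U'.PerL ∧ ¬ U'.PerL44 ∧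
      ¬ U'.RealisationExistsFace ∧ ¬ U'.PeriodThmF := by
  obtain ⟨U, M⟩ := h
  exact ⟨U.periodFree, M.periodFree, U.not_realisationExistsPerL_periodFree M.pull_hodge,
    U.not_perL_periodFree, U.not_perL44_periodFree,
    U.not_realisationExistsFace_periodFree M.pull_hodge, U.not_periodThmF_periodFree⟩

end HodgeCM

end
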